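import Mathlib.Analysis.Calculus.InverseFunctionTheorem.FDeriv
import Mathlib.Analysis.Calculus.InverseFunctionTheorem.ContDiff
import Mathlib.Analysis.Calculus.MeanValue
import Mathlib.Analysis.Calculus.ContDiff.RCLike
import Summits.FinalStateConjecture.FinalStateConjecture.Theorems.ZeroEnergyKerrOrBombHawkingExtensionIsKerrLevelSetTangential
import HarnessLib

/-!
# Crux `HawkingExtensionIsKerr` (stmt-FinalStateConjecture-17840), line `SketchIdeator2` —
# collar zeroth law, step G: functions with proportional differentials are constant on a regular
# level set

Helper file of the line lead (c3), programme "collar zeroth law".  Step G turns the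
infinitesimal zeroth law of step E (`dκ̃_q ∈ ℝ df_q` at every horizon point `q` near `p`) into
local constancy of `κ̃` on the horizon `{f = 0}` near a non-degenerate point: if `f`, `F` are `C¹`
near `p`, `df_p ≠ 0`, and `dF_q` is a multiple of `df_q` at every `q` near `p` with `f q = f p`,
then `F q = F p` for all such `q` (`eventually_eq_of_fderiv_eq_smul_on_levelSet`, Euclidean;
`eventually_eq_of_mvfderiv_eq_smul_on_levelSet`, on a manifold).  Proof: straighten `f` near `p`
by the local diffeomorphism `Ψ x = x + (f x - ℓ x) e` (`ℓ = df_p`, `ℓ e = 1`, `DΨ_p = id`,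
inverse function theorem), so that `f ∘ Ψ⁻¹ = ℓ`; on the affine hyperplane `{ℓ = f p}` the
function `F ∘ Ψ⁻¹` has a derivative proportional to `ℓ`, hence derivative `0` within the (convex)
hyperplane piece, hence is constant there (mean value inequality).
-/

noncomputable section

set_option linter.dupNamespace false

namespace Summit.FinalStateConjecture.FinalStateConjecture.Theorems.HawkingExtensionIsKerr.SketchIdeator2

open Set Function Filter Metric Literature.Geometry.Lorentzian
open scoped Topology ContDiff Manifold

section Euclidean

variable {E : Type*} [NormedAddCommGroup E] [NormedSpace ℝ E] [CompleteSpace E]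

/-- **Sherman–Morrison**: `v ↦ v + u(v) e` is invertible when `1 + u e ≠ 0`, with inverse
`v ↦ v - (1 + u e)⁻¹ u(v) e`. -/
def rankOnePerturbation (u : E →L[ℝ] ℝ) (e : E) (h : 1 + u e ≠ 0) : E ≃L[ℝ] E :=
  ContinuousLinearEquiv.equivOfInverse
    (ContinuousLinearMap.id ℝ E + u.smulRight e)
    (ContinuousLinearMap.id ℝ E - ((1 + u e)⁻¹ • u).smulRight e)
    (fun v ↦ by
      have hk : (1 + u e)⁻¹ * (1 + u e) = 1 := inv_mul_cancel₀ h
      have hcoef : u v - (1 + u e)⁻¹ * (u v + u v * u e) = 0 := by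
        linear_combination (-(u v)) * hk
      change (v + u v • e) - ((1 + u e)⁻¹ • u) (v + u v • e) • e = v
      rw [smul_apply, map_add, map_smul, smul_eq_mul, smul_eq_mul]
      calc v + u v • e - ((1 + u e)⁻¹ * (u v + u v * u e)) • e
          = v + (u v - (1 + u e)⁻¹ * (u v + u v * u e)) • e := by rw [sub_smul]; abel
        _ = v := by rw [hcoef, zero_smul, add_zero])
    (fun v ↦ by
      have hk : (1 + u e)⁻¹ * (1 + u e) = 1 := inv_mul_cancel₀ h
      have hcoef : -((1 + u e)⁻¹ * u v) + (u v - (1 + u e)⁻¹ * u v * u e) = 0 := by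
        linear_combination (-(u v)) * hk
      change (v - ((1 + u e)⁻¹ • u) v • e) + u (v - ((1 + u e)⁻¹ • u) v • e) • e = v
      rw [smul_apply, smul_eq_mul, map_sub, map_smul, smul_eq_mul]
      calc v - ((1 + u e)⁻¹ * u v) • e + (u v - (1 + u e)⁻¹ * u v * u e) • e
          = v + (-((1 + u e)⁻¹ * u v) + (u v - (1 + u e)⁻¹ * u v * u e)) • e := by
            rw [add_smul, neg_smul]; abel
        _ = v := by rw [hcoef, zero_smul, add_zero])

omit [CompleteSpace E] in
/-- The rank-one perturbation acts as `v ↦ v + u(v) e`. -/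
@[simp]
theorem rankOnePerturbation_apply (u : E →L[ℝ] ℝ) (e : E) (h : 1 + u e ≠ 0) (v : E) :
    rankOnePerturbation u e h v = v + u v • e := rfl

/-- **Step G, Euclidean core.**  Let `f F : E → ℝ` be `C¹` on a neighbourhood of `a`, `df_a ≠ 0`,
and suppose `dF_x ∈ ℝ df_x` for every `x` near `a` on the level set `{f = f a}`.  Then `F = F a`
on the level set near `a`. -/
theorem eventually_eq_of_fderiv_eq_smul_on_levelSet {f F : E → ℝ} {a : E}
    (hf : ∀ᶠ x in 𝓝 a, ContDiffAt ℝ 1 f x) (hF : ∀ᶠ x in 𝓝 a, ContDiffAt ℝ 1 F x)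
    (hdf : fderiv ℝ f a ≠ 0)
    (hprop : ∀ᶠ x in 𝓝 a, f x = f a → ∃ μ : ℝ, fderiv ℝ F x = μ • fderiv ℝ f x) :
    ∀ᶠ x in 𝓝 a, f x = f a → F x = F a := by
  -- normalise `ℓ = df_a` on a vector `e`
  set ℓ : E →L[ℝ] ℝ := fderiv ℝ f a with hℓ
  obtain ⟨e₁, he₁⟩ : ∃ e₁, ℓ e₁ ≠ 0 := by
    by_contra h
    push Not at h
    exact hdf (ContinuousLinearMap.ext fun v ↦ by rw [h v]; rfl)
  set e : E := (ℓ e₁)⁻¹ • e₁ with he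
  have hℓe : ℓ e = 1 := by rw [he, map_smul, smul_eq_mul, inv_mul_cancel₀ he₁]
  -- the straightening map `Ψ x = x + (f x - ℓ x) e`
  set Ψ : E → E := fun x ↦ x + (f x - ℓ x) • e with hΨ
  have hfa : ContDiffAt ℝ 1 f a := hf.self_of_nhds
  have hΨd : ∀ x, DifferentiableAt ℝ f x →
      HasFDerivAt Ψ (ContinuousLinearMap.id ℝ E + (fderiv ℝ f x - ℓ).smulRight e) x := by
    intro x hx
    have h1 : HasFDerivAt (fun x ↦ f x - ℓ x) (fderiv ℝ f x - ℓ) x :=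
      hx.hasFDerivAt.sub ℓ.hasFDerivAt
    exact (hasFDerivAt_id x).add (h1.smul_const e)
  have hΨa : HasFDerivAt Ψ ((ContinuousLinearEquiv.refl ℝ E : E ≃L[ℝ] E) : E →L[ℝ] E) a := by
    have h := hΨd a (hfa.differentiableAt one_ne_zero)
    rw [← hℓ, sub_self, ContinuousLinearMap.zero_smulRight, add_zero] at h
    exact h
  have hΨc : ContDiffAt ℝ 1 Ψ a :=
    contDiffAt_id.add ((hfa.sub ℓ.contDiff.contDiffAt).smul contDiffAt_const)
  set Φ := hΨc.toOpenPartialHomeomorph Ψ hΨa one_ne_zero with hΦ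
  have hΦcoe : (Φ : E → E) = Ψ := hΨc.toOpenPartialHomeomorph_coe hΨa one_ne_zero
  have haΦ : a ∈ Φ.source := hΨc.mem_toOpenPartialHomeomorph_source hΨa one_ne_zero
  have hΨaΦ : Ψ a ∈ Φ.target := by
    rw [← hΦcoe]; exact Φ.map_source haΦ
  -- `f ∘ Φ.symm = ℓ` on the target
  have hfsymm : ∀ y ∈ Φ.target, f (Φ.symm y) = ℓ y := by
    intro y hy
    have h := Φ.right_inv hy
    rw [hΦcoe] at h
    have := congrArg ℓ h
    simp only [hΨ, map_add, map_smul, smul_eq_mul, hℓe, mul_one] at this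
    linarith
  -- the derivative of `Ψ` is invertible near `a` (where `df(e) ≠ 0`), and `f`, `F` are `C¹`
  have hcont : ContinuousAt (fun x ↦ fderiv ℝ f x e) a :=
    ((hfa.fderiv_right (m := 0) le_rfl).continuousAt).clm_apply continuousAt_const
  have hdfe : ∀ᶠ x in 𝓝 a, fderiv ℝ f x e ≠ 0 := by
    refine hcont.eventually_ne ?_
    change ℓ e ≠ 0
    rw [hℓe]; exact one_ne_zero
  -- collect everything on a neighbourhood `W ⊆ Φ.source` of `a`
  obtain ⟨W, hWnhds, hW⟩ : ∃ W ∈ 𝓝 a, ∀ x ∈ W, x ∈ Φ.source ∧ ContDiffAt ℝ 1 f x ∧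
      ContDiffAt ℝ 1 F x ∧ fderiv ℝ f x e ≠ 0 ∧
      (f x = f a → ∃ μ : ℝ, fderiv ℝ F x = μ • fderiv ℝ f x) := by
    have h0 : ∀ᶠ x in 𝓝 a, x ∈ Φ.source := Φ.open_source.mem_nhds haΦ
    have h := h0.and (hf.and (hF.and (hdfe.and hprop)))
    exact ⟨_, h, fun x hx ↦ hx⟩
  -- a ball in the target whose preimage under `Φ.symm` lies in `W`
  have hsymm_cont : ContinuousAt Φ.symm (Ψ a) := Φ.symm.continuousAt hΨaΦ
  have hsymma : Φ.symm (Ψ a) = a := by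
    have := Φ.left_inv haΦ; rwa [hΦcoe] at this
  obtain ⟨r, hr, hball⟩ : ∃ r > 0, ball (Ψ a) r ⊆ Φ.target ∧
      ∀ y ∈ ball (Ψ a) r, Φ.symm y ∈ W := by
    have h1 : ∀ᶠ y in 𝓝 (Ψ a), y ∈ Φ.target := Φ.open_target.mem_nhds hΨaΦ
    have h2 : ∀ᶠ y in 𝓝 (Ψ a), Φ.symm y ∈ W := hsymm_cont.preimage_mem_nhds (by rwa [hsymma])
    obtain ⟨r, hr, h⟩ := Metric.eventually_nhds_iff_ball.mp (h1.and h2)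
    exact ⟨r, hr, fun y hy ↦ (h y hy).1, fun y hy ↦ (h y hy).2⟩
  -- the convex piece `s` of the hyperplane `{ℓ = ℓ (Ψ a)}` and `G = F ∘ Φ.symm`
  set s : Set E := ball (Ψ a) r ∩ {y | ℓ y = ℓ (Ψ a)} with hs
  have hsconv : Convex ℝ s := by
    refine (convex_ball _ _).inter ?_
    have : {y : E | ℓ y = ℓ (Ψ a)} = ℓ ⁻¹' {ℓ (Ψ a)} := rfl
    rw [this]
    exact (convex_singleton _).linear_preimage ℓ.toLinearMap
  set G : E → ℝ := F ∘ Φ.symm with hG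
  have hℓΨa : ℓ (Ψ a) = f a := by rw [← hfsymm _ hΨaΦ, hsymma]
  -- `G` has derivative `0` within `s` at every point of `s`
  have hGderiv : ∀ y ∈ s, HasFDerivWithinAt G (0 : E →L[ℝ] ℝ) s y := by
    rintro y ⟨hy, hyℓ⟩
    obtain ⟨hxsrc, hfx, hFx, hfxe, hpropx⟩ := hW _ (hball.2 y hy)
    set x := Φ.symm y with hx
    have hyt : y ∈ Φ.target := hball.1 hy
    have hfxval : f x = f a := by rw [hx, hfsymm y hyt, hyℓ, hℓΨa]
    obtain ⟨μ, hμ⟩ := hpropx hfxval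
    -- derivative of `Φ.symm` at `y`
    have h1e : 1 + (fderiv ℝ f x - ℓ) e ≠ 0 := by
      rw [sub_apply, hℓe]; ring_nf; exact hfxe
    set A := rankOnePerturbation (fderiv ℝ f x - ℓ) e h1e with hA
    have hΨx : HasFDerivAt Φ (A : E →L[ℝ] E) (Φ.symm y) := by
      rw [hΦcoe, ← hx]
      exact hΨd x (hfx.differentiableAt one_ne_zero)
    have hsymmd : HasFDerivAt Φ.symm (A.symm : E →L[ℝ] E) y := Φ.hasFDerivAt_symm hyt hΨx
    -- chain rule for `G` and for `f ∘ Φ.symm = ℓ`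
    have hGd : HasFDerivAt G ((fderiv ℝ F x).comp (A.symm : E →L[ℝ] E)) y :=
      (hFx.differentiableAt one_ne_zero).hasFDerivAt.comp y hsymmd
    have hfd : HasFDerivAt (f ∘ Φ.symm) ((fderiv ℝ f x).comp (A.symm : E →L[ℝ] E)) y :=
      (hfx.differentiableAt one_ne_zero).hasFDerivAt.comp y hsymmd
    have hfd' : HasFDerivAt (f ∘ Φ.symm) ℓ y := by
      refine ℓ.hasFDerivAt.congr_of_eventuallyEq ?_
      filter_upwards [Φ.open_target.mem_nhds hyt] with z hz
      exact hfsymm z hz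
    have hcomp : (fderiv ℝ f x).comp (A.symm : E →L[ℝ] E) = ℓ := hfd.unique hfd'
    have hGd' : HasFDerivAt G (μ • ℓ) y := by
      have : (fderiv ℝ F x).comp (A.symm : E →L[ℝ] E) = μ • ℓ := by
        rw [hμ, ContinuousLinearMap.smul_comp, hcomp]
      rwa [this] at hGd
    -- within the hyperplane piece the derivative `μ ℓ` acts as `0`
    rw [hasFDerivWithinAt_iff_isLittleO]
    have hG0 := (hGd'.hasFDerivWithinAt (s := s))
    rw [hasFDerivWithinAt_iff_isLittleO] at hG0
    refine hG0.congr' ?_ (Eventually.of_forall fun _ ↦ rfl)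
    filter_upwards [self_mem_nhdsWithin] with z hz
    have hzℓ : ℓ (z - y) = 0 := by rw [map_sub, hz.2, hyℓ, sub_self]
    simp only [FunLike.coe_smul, Pi.smul_apply, hzℓ, smul_zero, zero_apply]
  -- hence `G` is constant on `s`
  have hGconst : ∀ y ∈ s, G y = G (Ψ a) := by
    intro y hy
    have hΨas : Ψ a ∈ s := ⟨mem_ball_self hr, rfl⟩
    have h := hsconv.norm_image_sub_le_of_norm_hasFDerivWithin_le (f := G) (f' := fun _ ↦ 0)
      (C := 0) (fun z hz ↦ hGderiv z hz) (fun _ _ ↦ by simp) hΨas hy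
    simp only [zero_mul, norm_le_zero_iff, sub_eq_zero] at h
    exact h
  -- transport back: level-set points near `a` are mapped by `Ψ` into `s`
  have hΨcont : ContinuousAt Ψ a := hΨc.continuousAt
  have hmem : ∀ᶠ x in 𝓝 a, Ψ x ∈ ball (Ψ a) r := hΨcont.preimage_mem_nhds (ball_mem_nhds _ hr)
  filter_upwards [hmem, Φ.open_source.mem_nhds haΦ] with x hx hxsrc hfx
  have hℓΨx : ℓ (Ψ x) = ℓ (Ψ a) := by
    simp only [hΨ, map_add, map_smul, smul_eq_mul, hℓe, mul_one]
    rw [hfx]; ring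
  have h := hGconst (Ψ x) ⟨hx, hℓΨx⟩
  have hleft : ∀ z ∈ Φ.source, Φ.symm (Ψ z) = z := fun z hz ↦ by
    have := Φ.left_inv hz; rwa [hΦcoe] at this
  simp only [hG, comp_apply, hleft x hxsrc, hleft a haΦ] at h
  exact h

end Euclidean


section ManifoldWrapper

variable {E : Type*} [NormedAddCommGroup E] [NormedSpace ℝ E] [CompleteSpace E]
  {H : Type*} [TopologicalSpace H] {I : ModelWithCorners ℝ E H} [I.Boundaryless]
  {M : Type*} [TopologicalSpace M] [ChartedSpace H M] [IsManifold I 1 M]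

omit [CompleteSpace E] in
/-- A `C¹` real function read in the extended chart at `p` is `C¹` at the image of any point `q`
of the chart domain (boundaryless model). [folklore] -/
theorem contDiffAt_comp_extChartAt_symm_of_mem {f : M → ℝ} {p q : M}
    (hf : ContMDiffAt I 𝓘(ℝ, ℝ) 1 f q) (hq : q ∈ (extChartAt I p).source) :
    ContDiffAt ℝ 1 (f ∘ (extChartAt I p).symm) (extChartAt I p q) := by
  have h1 : ContMDiffWithinAt 𝓘(ℝ, E) I 1 (extChartAt I p).symm (range I) (extChartAt I p q) :=
    contMDiffWithinAt_extChartAt_symm_range (I := I) p ((extChartAt I p).map_source hq)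
  rw [ModelWithCorners.Boundaryless.range_eq_univ] at h1
  have h2 : ContMDiffAt I 𝓘(ℝ, ℝ) 1 f ((extChartAt I p).symm (extChartAt I p q)) := by
    rwa [(extChartAt I p).left_inv hq]
  have h := h2.comp_contMDiffWithinAt _ h1
  exact contMDiffAt_iff_contDiffAt.1 (h.contMDiffAt univ_mem)

omit [CompleteSpace E] in
/-- **Chain rule through the chart at `p`, at an arbitrary point of its target**: for `f`
differentiable at `φ⁻¹ x`, `D(f ∘ φ⁻¹)(x) = df_{φ⁻¹ x} ∘ D(φ⁻¹)(x)`, read as real-valued covectors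
(`mvfderiv`). [folklore] -/
theorem fderiv_comp_extChartAt_symm_apply {f : M → ℝ} {p : M} {x : E}
    (hx : x ∈ (extChartAt I p).target)
    (hf : MDifferentiableAt I 𝓘(ℝ, ℝ) f ((extChartAt I p).symm x)) (v : E) :
    fderiv ℝ (f ∘ (extChartAt I p).symm) x v =
      mvfderiv I f ((extChartAt I p).symm x) (mfderiv 𝓘(ℝ, E) I (extChartAt I p).symm x v) := by
  set φ := extChartAt I p with hφ
  have hsymm : MDifferentiableAt 𝓘(ℝ, E) I φ.symm x :=
    (mdifferentiableWithinAt_extChartAt_symm hx).mdifferentiableAt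
      (by rw [ModelWithCorners.Boundaryless.range_eq_univ]; exact univ_mem)
  have h1 : mvfderiv 𝓘(ℝ, E) (f ∘ φ.symm) x v = fderiv ℝ (f ∘ φ.symm) x v := by
    simp only [mvfderiv, ContinuousLinearMap.comp_apply, mfderiv_eq_fderiv]
    rfl
  rw [← h1]
  simp only [mvfderiv, ContinuousLinearMap.comp_apply]
  rw [mfderiv_comp x hf hsymm]
  rfl

/-- **Step G on a manifold.**  If `f`, `F` are `C¹` near `p`, `df_p ≠ 0`, and `dF_q ∈ ℝ df_q` for
every `q` near `p` with `f q = f p`, then `F q = F p` for all such `q` near `p`. -/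
theorem eventually_eq_of_mvfderiv_eq_smul_on_levelSet {f F : M → ℝ} {p : M}
    (hf : ∀ᶠ q in 𝓝 p, ContMDiffAt I 𝓘(ℝ, ℝ) 1 f q)
    (hF : ∀ᶠ q in 𝓝 p, ContMDiffAt I 𝓘(ℝ, ℝ) 1 F q) (hdf : mvfderiv I f p ≠ 0)
    (hprop : ∀ᶠ q in 𝓝 p, f q = f p → ∃ μ : ℝ, mvfderiv I F q = μ • mvfderiv I f q) :
    ∀ᶠ q in 𝓝 p, f q = f p → F q = F p := by
  set φ := extChartAt I p with hφ
  set e₀ : E := φ p with he₀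
  have hps : p ∈ φ.source := mem_extChartAt_source p
  have hpt : e₀ ∈ φ.target := mem_extChartAt_target p
  have hsymp : φ.symm e₀ = p := extChartAt_to_inv p
  -- everything near `p`, inside the chart domain
  have hsrc : ∀ᶠ q in 𝓝 p, q ∈ φ.source := (isOpen_extChartAt_source p).mem_nhds hps
  have hall := hsrc.and (hf.and (hF.and hprop))
  -- transported to the chart: near `e₀`
  have hcont : ContinuousAt φ.symm e₀ := continuousAt_extChartAt_symm p
  have htgt : ∀ᶠ x in 𝓝 e₀, x ∈ φ.target := extChartAt_target_mem_nhds p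
  have hall' : ∀ᶠ x in 𝓝 e₀, φ.symm x ∈ φ.source ∧ ContMDiffAt I 𝓘(ℝ, ℝ) 1 f (φ.symm x) ∧
      ContMDiffAt I 𝓘(ℝ, ℝ) 1 F (φ.symm x) ∧
      (f (φ.symm x) = f p → ∃ μ : ℝ, mvfderiv I F (φ.symm x) = μ • mvfderiv I f (φ.symm x)) :=
    hcont.eventually (by rw [hsymp]; exact hall)
  -- hypotheses of the Euclidean core for `f ∘ φ.symm`, `F ∘ φ.symm` at `e₀`
  have hfE : ∀ᶠ x in 𝓝 e₀, ContDiffAt ℝ 1 (f ∘ φ.symm) x := by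
    filter_upwards [htgt, hall'] with x hxt ⟨hxs, hfx, _, _⟩
    have := contDiffAt_comp_extChartAt_symm_of_mem (p := p) hfx hxs
    rwa [← hφ, φ.right_inv hxt] at this
  have hFE : ∀ᶠ x in 𝓝 e₀, ContDiffAt ℝ 1 (F ∘ φ.symm) x := by
    filter_upwards [htgt, hall'] with x hxt ⟨hxs, _, hFx, _⟩
    have := contDiffAt_comp_extChartAt_symm_of_mem (p := p) hFx hxs
    rwa [← hφ, φ.right_inv hxt] at this
  have hdfE : fderiv ℝ (f ∘ φ.symm) e₀ ≠ 0 := by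
    intro h0
    apply hdf
    ext v
    rw [mvfderiv_eq_fderiv_extChartAt_real (hf.self_of_nhds.mdifferentiableAt one_ne_zero) v,
      ← hφ, ← he₀, h0]
    rfl
  have hpropE : ∀ᶠ x in 𝓝 e₀, (f ∘ φ.symm) x = (f ∘ φ.symm) e₀ →
      ∃ μ : ℝ, fderiv ℝ (F ∘ φ.symm) x = μ • fderiv ℝ (f ∘ φ.symm) x := by
    filter_upwards [htgt, hall'] with x hxt ⟨hxs, hfx, hFx, hpx⟩ hfeq
    simp only [comp_apply, hsymp] at hfeq
    obtain ⟨μ, hμ⟩ := hpx hfeq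
    refine ⟨μ, ?_⟩
    ext v
    have h1 := fderiv_comp_extChartAt_symm_apply (p := p) hxt (hFx.mdifferentiableAt one_ne_zero) v
    have h2 := fderiv_comp_extChartAt_symm_apply (p := p) hxt (hfx.mdifferentiableAt one_ne_zero) v
    rw [h1, smul_apply, h2, hμ, smul_apply]
  -- the Euclidean core, pulled back along `φ`
  have hE := eventually_eq_of_fderiv_eq_smul_on_levelSet hfE hFE hdfE hpropE
  have hcontφ : ContinuousAt φ p := continuousAt_extChartAt p
  have hback : ∀ᶠ q in 𝓝 p, (f ∘ φ.symm) (φ q) = (f ∘ φ.symm) e₀ →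
      (F ∘ φ.symm) (φ q) = (F ∘ φ.symm) e₀ := hcontφ.eventually hE
  filter_upwards [hback, hsrc] with q hq hqs hfq
  simp only [comp_apply, φ.left_inv hqs, hsymp] at hq
  exact hq hfq

end ManifoldWrapper


/-- **Registered sub-goal form of step G** (closed statement over `E4`-charted manifolds, crux
stmt-FinalStateConjecture-17840): functions with proportional differentials are constant on a
regular level set. -/
theorem stub_levelSet_constancy : ∀ (M : Type) [TopologicalSpace M] [ChartedSpace E4 M] [IsManifold (𝓡 4) 1 M] (f F : M → ℝ) (p : M), (∀ᶠ q in 𝓝 p, ContMDiffAt (𝓡 4) 𝓘(ℝ, ℝ) 1 f q) → (∀ᶠ q in 𝓝 p, ContMDiffAt (𝓡 4) 𝓘(ℝ, ℝ) 1 F q) → mvfderiv (𝓡 4) f p ≠ 0 → (∀ᶠ q in 𝓝 p, f q = f p → ∃ μ : ℝ, mvfderiv (𝓡 4) F q = μ • mvfderiv (𝓡 4) f q) → ∀ᶠ q in 𝓝 p, f q = f p → F q = F p :=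
  fun _ _ _ _ _ _ _ hf hF hdf hprop ↦ eventually_eq_of_mvfderiv_eq_smul_on_levelSet hf hF hdf hprop

end Summit.FinalStateConjecture.FinalStateConjecture.Theorems.HawkingExtensionIsKerr.SketchIdeator2

end
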